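import Literature.NumberTheory.EllipticCurves.IsogenyVariableChangeProofs
import Literature.NumberTheory.EllipticCurves.IsogenyTwoTorsionProofs
import Literature.NumberTheory.EllipticCurves.IsogenyHomProofs
import Literature.NumberTheory.EllipticCurves.FrobeniusEquivariantProofs
import Literature.NumberTheory.EllipticCurves.GaloisActionProofs
import Literature.NumberTheory.EllipticCurves.TateModuleProofs
import HarnessLib

/-!
# Characteristic `2`: a Frobenius acting as an integer forces `j = 0` and non-commuting automorphisms

Sibling file of `Literature.NumberTheory.EllipticCurves.Isogeny` (D-0014; theorems only),
serving the central case of Tate's theorem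
`Literature.AlgebraicGeometry.Motives.mem_span_range_tateEndRingHom_iff_of_finite` (Tate, Invent. Math. 2 (1966), Main
Theorem, `End` form) in characteristic `2`, where the prime `2` is not available for the
`2`-isogeny argument of `FaltingsECTateCyclicQuotientProofs`. Let `k` be a finite field of
characteristic `2`, `σ_q` its arithmetic Frobenius and `E / k` an elliptic curve whose Frobenius
acts on `E(k̄)` as an integer: `σ_q P = m P` for all `P` (the central case, by
`FaltingsECTateFrobeniusScalarProofs`). Then:

* `WeierstrassCurve.even_of_frobenius_smul_eq_zsmul`: `m` is even (an odd `m` with `|m| ≥ 3`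
  would give `σ_q P = m P = O` on the non-zero group `E[m]`; `m = ±1` would put every `x(P)` in
  `k`, making `E(k̄)` finite);
* `WeierstrassCurve.a₁_eq_zero_of_frobenius_smul_eq_zsmul`: `a₁ = 0`, i.e. `j(E) = 0` and `E`
  is supersingular (`E[2] = O` since `σ_q T = m T = O` for `2T = O`; and in characteristic `2` a
  curve with `a₁ ≠ 0` has the point `(a₃/a₁, √·)` of order `2`); then `a₃ ≠ 0`
  (`a₃_ne_zero_of_a₁_eq_zero_of_two_eq_zero`, `Δ = a₃⁴`);
* `WeierstrassCurve.exists_endRing_mul_ne_mul_of_frobenius_smul_eq_zsmul_of_two_eq_zero`: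
  **`End_k(E)` is not commutative**: for `y² + a₃y = x³ + a₂x² + a₄x + a₆` the substitutions
  `(x, y) ↦ (x + s², y + sx + t)` with `s³ = a₃`, `t² + a₃t = s⁶ + a₂s⁴ + a₄s²` are automorphisms
  of `E` (Silverman, *AEC*, Appendix A, Prop. A.1.2(c) and Exercise A.1(b): for `j = 0` in
  characteristic `2`, `Aut(E)` has order `24`), two of them with distinct `s` do not commute
  (the `y`-coordinates of the two composites differ by `ss'(s + s') ≠ 0`), and they commute with
  `Γ_k` because `σ_q` acts as the integer `m` and every `τ ∈ Γ_k` acts on finitely many points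
  as a power of `σ_q` (the tree's `exists_smul_eq_frobenius_pow_smul_of_finite`).

## References

* [SilvermanAEC2009] J. H. Silverman, *The Arithmetic of Elliptic Curves*, 2nd ed., GTM 106,
  III.1 (Table 3.1), Appendix A (Prop. A.1.1(c), Prop. A.1.2(c), Exercise A.1(b)), Thm. V.3.1.
* [Tate1966Endomorphisms] J. Tate, *Endomorphisms of abelian varieties over finite fields*,
  Invent. Math. 2 (1966), 134–144, Main Theorem.
* [Waterhouse1969] W. C. Waterhouse, *Abelian varieties over finite fields*, Ann. Sci. ÉNS (4) 2
  (1969), Thm. 4.1 (2) (`β = ±2√q`: supersingular, all endomorphisms defined over `k`).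
-/

noncomputable section

open scoped Classical

universe u

namespace WeierstrassCurve

open geomPoints

variable {K : Type u} [Field K] (W : WeierstrassCurve K)

/-! ## Points with `x`-coordinate in a finite set -/

/-- The affine geometric points whose `x`-coordinate lies in a finite set form a finite set
(at most two `y` for each `x`). [folklore] -/
theorem finite_setOf_x_mem {S : Set (AlgebraicClosure K)} (hS : S.Finite) :
    {P : W.geomPoints | ∃ (x y : AlgebraicClosure K)
      (h : (W.baseChange (AlgebraicClosure K)).toAffine.Nonsingular x y),
        P = Affine.Point.some x y h ∧ x ∈ S}.Finite := by
  set qx : AlgebraicClosure K → Polynomial (AlgebraicClosure K) := fun x ↦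
    (W.baseChange (AlgebraicClosure K)).toAffine.polynomial.map (Polynomial.evalRingHom x) with hqx
  have hqx0 : ∀ x, qx x ≠ 0 := fun x ↦
    ((W.baseChange (AlgebraicClosure K)).toAffine.monic_polynomial.map _).ne_zero
  set T : Set (AlgebraicClosure K × AlgebraicClosure K) :=
    {xy | xy.1 ∈ S ∧ (qx xy.1).IsRoot xy.2} with hT
  have hTfin : T.Finite := by
    refine (hS.biUnion fun x _ ↦ (Polynomial.finite_setOf_isRoot (hqx0 x)).image (Prod.mk x)).subset
      ?_
    rintro ⟨x, y⟩ ⟨hx, hy⟩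
    exact Set.mem_biUnion hx ⟨y, hy, rfl⟩
  let f : W.geomPoints → Option (AlgebraicClosure K × AlgebraicClosure K) := fun P ↦
    match (P : (W.baseChange (AlgebraicClosure K)).toAffine.Point) with
    | .zero => none
    | .some x y _ => some (x, y)
  have hf : Function.Injective f := by
    intro P Q hPQ
    change (W.baseChange (AlgebraicClosure K)).toAffine.Point at P Q
    rcases P with _ | ⟨x, y, h⟩ <;> rcases Q with _ | ⟨x', y', h'⟩
    · rfl
    · simp [f] at hPQ
    · simp [f] at hPQ
    · simp only [f, Option.some.injEq, Prod.mk.injEq] at hPQ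
      obtain ⟨rfl, rfl⟩ := hPQ
      rfl
  refine ((hTfin.image fun xy ↦
    (some xy : Option (AlgebraicClosure K × AlgebraicClosure K))).preimage hf.injOn).subset ?_
  rintro P ⟨x, y, h, rfl, hx⟩
  refine ⟨(x, y), ⟨hx, ?_⟩, rfl⟩
  change (qx x).IsRoot y
  rw [Polynomial.IsRoot.def, hqx, Polynomial.map_evalRingHom_eval]
  exact h.left

/-! ## A Frobenius acting as an integer in characteristic `2`: `m` even, `a₁ = 0`, `a₃ ≠ 0` -/

section Finite

variable [Finite K] [W.IsElliptic] {σ : Field.absoluteGaloisGroup K}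

/-- If the Frobenius of a finite field acts on `E(k̄)` as `±1` up to sign — `σ_q P = P` or
`σ_q P = -P` for every `P` — we reach a contradiction: every `x(P)` is then fixed by the `q`-power
map, so lies in `k`, and `E(k̄)` would be finite. [folklore] -/
theorem false_of_frobenius_smul_eq_or_eq_neg
    (hσ : ∀ x : AlgebraicClosure K, σ • x = x ^ Nat.card K)
    (h : ∀ P : W.geomPoints, σ • P = P ∨ σ • P = -P) : False := by
  have hfin := finite_setOf_x_mem W (Set.finite_range (algebraMap K (AlgebraicClosure K)))
  refine Set.infinite_univ (α := W.geomPoints) ((hfin.insert 0).subset fun P _ ↦ ?_)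
  by_cases hP0 : P = 0
  · exact Or.inl hP0
  refine Or.inr ?_
  have hP := h P
  change (W.baseChange (AlgebraicClosure K)).toAffine.Point at P
  rcases P with _ | ⟨x, y, hxy⟩
  · exact absurd rfl hP0
  refine ⟨x, y, hxy, rfl, mem_range_algebraMap_of_pow_card_eq ((hσ x).symm.trans ?_)⟩
  obtain ⟨h', e'⟩ := smul_eq_some_of_eq' W σ (P := (Affine.Point.some x y hxy : W.geomPoints)) rfl
  rw [e'] at hP
  exact Affine.Point.X_eq_iff.mpr hP

omit [Finite K] [W.IsElliptic] in
/-- Powers of the Frobenius act as powers of `m` when `σ_q = m` on `E(k̄)`. [folklore] -/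
theorem frobenius_pow_smul_eq_pow_zsmul {m : ℤ} (hm : ∀ P : W.geomPoints, σ • P = m • P) (j : ℕ)
    (P : W.geomPoints) : σ ^ j • P = m ^ j • P := by
  induction j generalizing P with
  | zero => rw [pow_zero, one_smul, pow_zero, one_smul]
  | succ j ih => rw [pow_succ, mul_smul, hm, smul_comm, ih, smul_smul, ← pow_succ']

omit [W.IsElliptic] in
/-- A map of `E(k̄)` into itself commuting with the integer `m`, where `σ_q = m` on `E(k̄)`,
commutes with all of `Γ_k` (every `τ ∈ Γ_k` is a power of `σ_q` on finitely many points, the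
tree's `exists_smul_eq_frobenius_pow_smul_of_finite`). [folklore] -/
theorem smul_comm_of_frobenius_smul_eq_zsmul (hσ : ∀ x : AlgebraicClosure K, σ • x = x ^ Nat.card K)
    {m : ℤ} (hm : ∀ P : W.geomPoints, σ • P = m • P) (α : W.geomPoints →+ W.geomPoints)
    (τ : Field.absoluteGaloisGroup K) (P : W.geomPoints) : α (τ • P) = τ • α P := by
  obtain ⟨j, hj⟩ := exists_smul_eq_frobenius_pow_smul_of_finite W hσ τ
    (Set.toFinite ({P, α P} : Set W.geomPoints))
  rw [hj P (by simp), hj (α P) (by simp), frobenius_pow_smul_eq_pow_zsmul W hm,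
    frobenius_pow_smul_eq_pow_zsmul W hm, map_zsmul]

/-- **If the Frobenius of a finite field of characteristic `2` acts on `E(k̄)` as an integer `m`,
then `m` is even**: if `m` is odd and `|m| ≥ 3` then `m ≠ 0` in `k`, so `E[m]` has `m² > 1`
points (Silverman, *AEC*, Cor. III.6.4(b)) and is killed by `σ_q = m`, impossible since `σ_q` is
injective on `E(k̄)`; if `m = ±1` then `σ_q P = ±P` for all `P`, impossible by
`false_of_frobenius_smul_eq_or_eq_neg`. [folklore] -/
theorem even_of_frobenius_smul_eq_zsmul (h2 : (2 : K) = 0)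
    (hσ : ∀ x : AlgebraicClosure K, σ • x = x ^ Nat.card K) {m : ℤ}
    (hm : ∀ P : W.geomPoints, σ • P = m • P) : Even m := by
  by_contra hodd
  rw [Int.not_even_iff_odd] at hodd
  -- `|m| ≠ 1`: otherwise `σ = ±1` on `E(k̄)`
  have hm1 : m.natAbs ≠ 1 := by
    intro h1
    refine false_of_frobenius_smul_eq_or_eq_neg W hσ fun P ↦ ?_
    rcases Int.natAbs_eq m with hm' | hm'
    · left
      rw [hm, hm', h1, Nat.cast_one, one_smul]
    · right
      rw [hm, hm', h1, Nat.cast_one, neg_smul, one_smul]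
  -- `|m| ≠ 0` in `k` (it is odd and `char k = 2`)
  obtain ⟨j, hj⟩ := hodd
  have hmK : ((m.natAbs : ℕ) : AlgebraicClosure K) ≠ 0 := by
    have h2L : (2 : AlgebraicClosure K) = 0 := by
      rw [← map_ofNat (algebraMap K (AlgebraicClosure K)) 2, h2, map_zero]
    have hjabs : m.natAbs = 2 * j.natAbs + 1 ∨ m.natAbs + 1 = 2 * j.natAbs := by omega
    rcases hjabs with h | h
    · rw [h, Nat.cast_add, Nat.cast_mul, Nat.cast_ofNat, h2L, zero_mul, zero_add, Nat.cast_one]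
      exact one_ne_zero
    · intro h0
      have := congrArg (fun n : ℕ ↦ (n : AlgebraicClosure K)) h
      simp only [Nat.cast_add, Nat.cast_one, h0, zero_add, Nat.cast_mul, Nat.cast_ofNat, h2L,
        zero_mul] at this
      exact one_ne_zero this
  -- a non-zero point of `E[|m|]`
  have hcard : Nat.card (geomTorsion W (m.natAbs : ℕ)) = m.natAbs ^ 2 :=
    card_torsionPoints_eq_sq_holds W (AlgebraicClosure K) hmK
  have h1lt : 1 < Nat.card (geomTorsion W (m.natAbs : ℕ)) := by
    rw [hcard]
    have : 1 < m.natAbs := by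
      rcases Nat.lt_or_ge 1 m.natAbs with h | h
      · exact h
      · exfalso
        interval_cases hk : m.natAbs
        · omega
        · exact hm1 rfl
    nlinarith
  haveI : Finite (geomTorsion W (m.natAbs : ℕ)) := Nat.finite_of_card_ne_zero (by omega)
  haveI : Nontrivial (geomTorsion W (m.natAbs : ℕ)) := Finite.one_lt_card_iff_nontrivial.mp h1lt
  obtain ⟨⟨P, hP⟩, hP0⟩ := exists_ne (0 : geomTorsion W (m.natAbs : ℕ))
  have hPm : m • P = 0 := by
    have hP' : ((m.natAbs : ℕ) : ℤ) • P = 0 := (Submodule.mem_torsionBy_iff _ _).mp hP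
    rcases Int.natAbs_eq m with hm' | hm'
    · rw [hm']
      exact hP'
    · rw [hm', neg_smul, hP', neg_zero]
  refine hP0 (Subtype.ext ((smul_eq_zero_iff_eq σ).mp ?_))
  change σ • P = 0
  rw [hm, hPm]

/-- **A curve whose Frobenius acts as an integer has no point of order `2` in characteristic `2`**:
`σ_q T = m T = O` since `m` is even. [folklore] -/
theorem eq_zero_of_two_nsmul_eq_zero_of_frobenius_smul_eq_zsmul (h2 : (2 : K) = 0)
    (hσ : ∀ x : AlgebraicClosure K, σ • x = x ^ Nat.card K) {m : ℤ}
    (hm : ∀ P : W.geomPoints, σ • P = m • P) {T : W.geomPoints} (hT : 2 • T = 0) : T = 0 := by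
  obtain ⟨j, rfl⟩ := even_of_frobenius_smul_eq_zsmul W h2 hσ hm
  refine (smul_eq_zero_iff_eq σ).mp ?_
  rw [hm, add_smul, ← two_smul ℤ, smul_comm, show (2 : ℤ) • T = 0 by exact_mod_cast hT,
    smul_zero]

omit [Finite K] in
/-- In characteristic `2`, a Weierstrass curve with `a₁ ≠ 0` has a point of order `2` over `K̄`:
`T = (a₃/a₁, y₀)` with `y₀² = x₀³ + a₂x₀² + a₄x₀ + a₆` (then `a₁x₀ + a₃ = 0`, so `-T = T`).
Silverman, *AEC*, Appendix A, Prop. A.1.1(c) (`ψ₂ = a₁x + a₃` in characteristic `2`).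
[cite: SilvermanAEC2009, Appendix A, Prop. A.1.1(c)] -/
theorem exists_two_nsmul_eq_zero_of_a₁_ne_zero (h2 : (2 : K) = 0) (ha₁ : W.a₁ ≠ 0) :
    ∃ T : W.geomPoints, T ≠ 0 ∧ 2 • T = 0 := by
  let L := AlgebraicClosure K
  let V : WeierstrassCurve L := W.baseChange L
  have h2L : (2 : L) = 0 := by rw [← map_ofNat (algebraMap K L) 2, h2, map_zero]
  have ha₁L : V.a₁ ≠ 0 := by
    simp only [V, L, baseChange, map_a₁]
    exact fun h ↦ ha₁ ((algebraMap K L).injective (h.trans (map_zero _).symm))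
  set x₀ : L := V.a₃ / V.a₁ with hx₀
  have hx₀' : V.a₁ * x₀ + V.a₃ = 0 := by
    rw [hx₀, mul_div_cancel₀ _ ha₁L, ← two_mul, h2L, zero_mul]
  obtain ⟨y₀, hy₀⟩ := IsAlgClosed.exists_eq_mul_self (x₀ ^ 3 + V.a₂ * x₀ ^ 2 + V.a₄ * x₀ + V.a₆)
  have heq : V.toAffine.Equation x₀ y₀ := by
    rw [Affine.equation_iff]
    linear_combination (-1 : L) * hy₀ + y₀ * hx₀'
  have hns : V.toAffine.Nonsingular x₀ y₀ := Affine.equation_iff_nonsingular.mp heq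
  refine ⟨Affine.Point.some x₀ y₀ hns, Affine.Point.some_ne_zero hns, ?_⟩
  have hneg : y₀ = V.toAffine.negY x₀ y₀ := by
    rw [Affine.negY]
    linear_combination hx₀' + y₀ * h2L
  rw [two_nsmul]
  exact Affine.Point.add_self_of_Y_eq hneg

/-- **If the Frobenius acts on `E(k̄)` as an integer and `char k = 2`, then `a₁ = 0`** (so
`j(E) = 0` and `E` is supersingular, Silverman, *AEC*, Thm. V.3.1 and Exercise A.1(b) / Prop. A.1.1(c);
Waterhouse, Thm. 4.1 (2)). [cite: SilvermanAEC2009, Appendix A, Prop. A.1.1(c)] -/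
theorem a₁_eq_zero_of_frobenius_smul_eq_zsmul (h2 : (2 : K) = 0)
    (hσ : ∀ x : AlgebraicClosure K, σ • x = x ^ Nat.card K) {m : ℤ}
    (hm : ∀ P : W.geomPoints, σ • P = m • P) : W.a₁ = 0 := by
  by_contra ha₁
  obtain ⟨T, hT0, hT⟩ := exists_two_nsmul_eq_zero_of_a₁_ne_zero W h2 ha₁
  exact hT0 (eq_zero_of_two_nsmul_eq_zero_of_frobenius_smul_eq_zsmul W h2 hσ hm hT)

end Finite

/-- In characteristic `2`, a Weierstrass curve with `a₁ = a₃ = 0` is singular (`Δ` is even as a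
polynomial in the coefficients). Silverman, *AEC*, Appendix A, Prop. A.1.1(c) (`Δ = a₃⁴` when
`a₁ = 0`). [cite: SilvermanAEC2009, Appendix A, Prop. A.1.1(c)] -/
theorem a₃_ne_zero_of_a₁_eq_zero_of_two_eq_zero [W.IsElliptic] (h2 : (2 : K) = 0)
    (ha₁ : W.a₁ = 0) : W.a₃ ≠ 0 := by
  intro ha₃
  apply W.isUnit_Δ.ne_zero
  have : W.Δ = 2 * (-8 * W.a₂ ^ 2 * (4 * W.a₂ * W.a₆ - W.a₄ ^ 2) - 32 * W.a₄ ^ 3 - 216 * W.a₆ ^ 2 +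
      144 * W.a₂ * W.a₄ * W.a₆) := by
    rw [Δ, b₂, b₄, b₆, b₈, ha₁, ha₃]
    ring
  rw [this, h2, zero_mul]

/-! ## The automorphisms `(x, y) ↦ (x + s², y + sx + t)` of `y² + a₃y = x³ + a₂x² + a₄x + a₆` -/

section Aut

variable {L : Type u} [Field L] (V : WeierstrassCurve L)

/-- In characteristic `2`, for `V : y² + a₃y = x³ + a₂x² + a₄x + a₆` (`a₁ = 0`), `s` with
`s³ = a₃` and `t` with `t² + a₃t + (s⁶ + a₂s⁴ + a₄s²) = 0`, the change of variables
`(u, r, s, t) = (1, s², s, t)` fixes the equation: `(1, s², s, t) • V = V` — i.e.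
`(x, y) ↦ (x + s², y + sx + s³ + t)` is an automorphism of `V`. Silverman, *AEC*, Appendix A,
Prop. A.1.2(c) / Exercise A.1(b) (the automorphisms `x = u²x' + s²`, `y = u³y' + u²sx' + t` of
`j = 0` curves in characteristic `2`). [cite: SilvermanAEC2009, Appendix A, Exercise A.1(b)] -/
theorem smul_eq_self_of_charTwo (h2 : (2 : L) = 0) (ha₁ : V.a₁ = 0) {s t : L} (hs : s ^ 3 = V.a₃)
    (ht : t ^ 2 + V.a₃ * t + (s ^ 6 + V.a₂ * s ^ 4 + V.a₄ * s ^ 2) = 0) :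
    (⟨1, s ^ 2, s, t⟩ : VariableChange L) • V = V := by
  ext
  · simp only [variableChange_a₁, Units.val_one, inv_one, one_mul, ha₁]
    linear_combination s * h2
  · simp only [variableChange_a₂, Units.val_one, inv_one, one_pow, one_mul, ha₁]
    linear_combination s ^ 2 * h2
  · simp only [variableChange_a₃, Units.val_one, inv_one, one_pow, one_mul, ha₁]
    linear_combination t * h2
  · simp only [variableChange_a₄, Units.val_one, inv_one, one_pow, one_mul, ha₁]
    linear_combination s * hs + (s ^ 2 * V.a₂ + s ^ 4 - s * t) * h2
  · simp only [variableChange_a₆, Units.val_one, inv_one, one_pow, one_mul, ha₁]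
    linear_combination (-1 : L) * ht + (s ^ 6 + V.a₂ * s ^ 4 + V.a₄ * s ^ 2) * h2

end Aut

/-! ## Non-commutativity of `End_k(E)` -/

section Main

variable [Finite K] [W.IsElliptic] {σ : Field.absoluteGaloisGroup K}

/-- **The automorphism `(x, y) ↦ (x - s², y - s(x - s²) - t)` as an element of `End_k(E)`.** Let
`k` be finite of characteristic `2`, `E / k` elliptic with Frobenius `σ_q = m` on `E(k̄)` (so
`a₁ = 0`), and `s, t ∈ k̄` with `s³ = a₃`, `t² + a₃t + (s⁶ + a₂s⁴ + a₄s²) = 0`. The substitution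
isomorphism of `C = (1, s², s, t)` (the tree's `VariableChange.pointEquiv`), read on `E(k̄)`
through `C • E = E` (`smul_eq_self_of_charTwo`), is an additive, algebraic (polynomial) map
`E(k̄) → E(k̄)` commuting with `Γ_k` (`smul_comm_of_frobenius_smul_eq_zsmul`): an element of
`End_k(E) = W.endRing`. Silverman, *AEC*, Appendix A, Exercise A.1(b); III.§4.
[cite: SilvermanAEC2009, Appendix A, Exercise A.1(b)] -/
theorem exists_mem_endRing_apply_some_eq (h2 : (2 : K) = 0)
    (hσ : ∀ x : AlgebraicClosure K, σ • x = x ^ Nat.card K) {m : ℤ}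
    (hm : ∀ P : W.geomPoints, σ • P = m • P) {s t : AlgebraicClosure K}
    (hs : s ^ 3 = (W.baseChange (AlgebraicClosure K)).a₃)
    (ht : t ^ 2 + (W.baseChange (AlgebraicClosure K)).a₃ * t +
      (s ^ 6 + (W.baseChange (AlgebraicClosure K)).a₂ * s ^ 4 +
        (W.baseChange (AlgebraicClosure K)).a₄ * s ^ 2) = 0) :
    ∃ α : AddMonoid.End W.geomPoints, α ∈ W.endRing ∧
      ∀ (x y : AlgebraicClosure K) (h : (W.baseChange (AlgebraicClosure K)).toAffine.Nonsingular x y),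
        ∃ h', α (Affine.Point.some x y h) =
          Affine.Point.some (x - s ^ 2) (y - s * (x - s ^ 2) - t) h' := by
  have h2L : (2 : AlgebraicClosure K) = 0 := by
    rw [← map_ofNat (algebraMap K (AlgebraicClosure K)) 2, h2, map_zero]
  have ha₁L : (W.baseChange (AlgebraicClosure K)).a₁ = 0 := by
    simp [baseChange, map_a₁, a₁_eq_zero_of_frobenius_smul_eq_zsmul W h2 hσ hm]
  have hCV := smul_eq_self_of_charTwo (W.baseChange (AlgebraicClosure K)) h2L ha₁L hs ht
  let α : AddMonoid.End W.geomPoints :=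
    (Affine.Point.congrEquiv hCV).toAddMonoidHom.comp
      (VariableChange.pointEquiv (W.baseChange (AlgebraicClosure K))
        (⟨1, s ^ 2, s, t⟩ : VariableChange (AlgebraicClosure K))).toAddMonoidHom
  have hα : ∀ (x y : AlgebraicClosure K)
      (h : (W.baseChange (AlgebraicClosure K)).toAffine.Nonsingular x y), ∃ h',
        α (Affine.Point.some x y h) = Affine.Point.some (x - s ^ 2) (y - s * (x - s ^ 2) - t) h' := by
    intro x y h
    have e1 : α (Affine.Point.some x y h) = Affine.Point.congrEquiv hCV
        (VariableChange.pointEquiv (W.baseChange (AlgebraicClosure K))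
          (⟨1, s ^ 2, s, t⟩ : VariableChange (AlgebraicClosure K)) (Affine.Point.some x y h)) := rfl
    rw [VariableChange.pointEquiv_some, Affine.Point.congrEquiv_some] at e1
    obtain ⟨h', e'⟩ := Literature.NumberTheory.EllipticCurves.UnivEC.some_eq_some_of_eq
      (x' := x - s ^ 2) (y' := y - s * (x - s ^ 2) - t)
      (by simp [VariableChange.toX_def]) (by simp [VariableChange.toY_def])
      (hCV ▸ (VariableChange.nonsingular_iff (W.baseChange (AlgebraicClosure K))
        (⟨1, s ^ 2, s, t⟩ : VariableChange (AlgebraicClosure K)) x y).mpr h)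
    exact ⟨h', e1.trans e'⟩
  refine ⟨α, ⟨Subring.subset_closure ?_, fun τ P ↦ ?_⟩, hα⟩
  · -- algebraic: the polynomial map `(X₀ - s², X₁ - s(X₀ - s²) - t)`
    refine ⟨MvPolynomial.X 0 - MvPolynomial.C (s ^ 2), 1,
      MvPolynomial.X 1 - MvPolynomial.C s * (MvPolynomial.X 0 - MvPolynomial.C (s ^ 2)) -
        MvPolynomial.C t, 1, (Set.finite_singleton (0 : W.geomPoints)).subset fun P hP ↦ ?_⟩
    by_contra hP0
    refine hP ?_
    change (W.baseChange (AlgebraicClosure K)).toAffine.Point at P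
    rcases P with _ | ⟨x, y, h⟩
    · exact absurd rfl hP0
    · obtain ⟨h', e'⟩ := hα x y h
      exact agreesWithRationalMapAt_some_of_eq h _ e' (by simp) (by simp) (by simp) (by simp)
  · exact smul_comm_of_frobenius_smul_eq_zsmul W hσ hm α τ P

/-- **In characteristic `2`, an elliptic curve over a finite field whose Frobenius acts on `E(k̄)`
as an integer has non-commutative `End_k(E)`.** Let `k` be finite with `2 = 0` in `k`, `σ_q` its
arithmetic Frobenius, `E / k` elliptic with `σ_q P = m P` for all `P ∈ E(k̄)` (the central case of
Tate's theorem). Then `a₁ = 0` (`a₁_eq_zero_of_frobenius_smul_eq_zsmul`), `a₃ ≠ 0`, and for two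
distinct cube roots `s, s' = ωs` of `a₃` the automorphisms `(x, y) ↦ (x - s², y - s(x - s²) - t)`
and `(x, y) ↦ (x - s'², y - s'(x - s'²) - t')` of `E` over `k̄` lie in `End_k(E)`
(`exists_mem_endRing_apply_some_eq`) and do not commute: the `y`-coordinates of their two
composites at any affine point differ by `ss'(s' - s) ≠ 0`. (Silverman, *AEC*, Appendix A,
Prop. A.1.2(c): `Aut(E)` is the non-abelian group of order `24` for `j = 0` in characteristic `2`;
Waterhouse, Ann. Sci. ÉNS 2 (1969), Thm. 4.1 (2): these curves are supersingular with all
endomorphisms defined over `k`, `End_k(E) ⊗ ℚ` a quaternion algebra.)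
[cite: SilvermanAEC2009, Appendix A, Prop. A.1.2(c) and Exercise A.1(b)] -/
theorem exists_endRing_mul_ne_mul_of_frobenius_smul_eq_zsmul_of_two_eq_zero (h2 : (2 : K) = 0)
    (hσ : ∀ x : AlgebraicClosure K, σ • x = x ^ Nat.card K) {m : ℤ}
    (hm : ∀ P : W.geomPoints, σ • P = m • P) :
    ∃ a b : W.endRing, a * b ≠ b * a := by
  have h2L : (2 : AlgebraicClosure K) = 0 := by
    rw [← map_ofNat (algebraMap K (AlgebraicClosure K)) 2, h2, map_zero]
  have ha₁L : (W.baseChange (AlgebraicClosure K)).a₁ = 0 := by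
    simp [baseChange, map_a₁, a₁_eq_zero_of_frobenius_smul_eq_zsmul W h2 hσ hm]
  have ha₃L : (W.baseChange (AlgebraicClosure K)).a₃ ≠ 0 :=
    a₃_ne_zero_of_a₁_eq_zero_of_two_eq_zero _ h2L ha₁L
  -- two distinct cube roots `s`, `s' = ω s` of `a₃`
  obtain ⟨s, hs⟩ := IsAlgClosed.exists_pow_nat_eq (W.baseChange (AlgebraicClosure K)).a₃
    (by norm_num : 0 < 3)
  have hs0 : s ≠ 0 := by
    rintro rfl
    exact ha₃L (by rw [← hs]; ring)
  obtain ⟨ω, hω⟩ : ∃ ω : AlgebraicClosure K, ω ^ 2 + ω + 1 = 0 := by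
    obtain ⟨ω, hω⟩ := IsAlgClosed.exists_root
      (Polynomial.C 1 * Polynomial.X ^ 2 + Polynomial.C 1 * Polynomial.X + Polynomial.C 1 :
        Polynomial (AlgebraicClosure K)) (by
        rw [Polynomial.degree_quadratic one_ne_zero]
        exact two_ne_zero)
    exact ⟨ω, by simpa using hω⟩
  have hω1 : ω ≠ 1 := by
    rintro rfl
    have h3 : (3 : AlgebraicClosure K) = 0 := by linear_combination hω
    have h1 : (1 : AlgebraicClosure K) = 0 := by linear_combination h3 - h2L
    exact one_ne_zero h1
  have hω3 : ω ^ 3 = 1 := by linear_combination (ω - 1) * hω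
  set s' : AlgebraicClosure K := ω * s with hs'def
  have hs' : s' ^ 3 = (W.baseChange (AlgebraicClosure K)).a₃ := by
    rw [hs'def, mul_pow, hω3, one_mul, hs]
  have hs'0 : s' ≠ 0 := mul_ne_zero (fun h ↦ by rw [h] at hω; simp at hω) hs0
  have hss' : s' - s ≠ 0 := by
    rw [hs'def, ← sub_one_mul]
    exact mul_ne_zero (sub_ne_zero.mpr hω1) hs0
  -- the constants `t`, `t'`
  have hquad : ∀ r : AlgebraicClosure K, ∃ τ : AlgebraicClosure K,
      τ ^ 2 + (W.baseChange (AlgebraicClosure K)).a₃ * τ +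
        (r ^ 6 + (W.baseChange (AlgebraicClosure K)).a₂ * r ^ 4 +
          (W.baseChange (AlgebraicClosure K)).a₄ * r ^ 2) = 0 := fun r ↦ by
    obtain ⟨τ, hτ⟩ := IsAlgClosed.exists_root
      (Polynomial.C 1 * Polynomial.X ^ 2 +
        Polynomial.C (W.baseChange (AlgebraicClosure K)).a₃ * Polynomial.X +
        Polynomial.C (r ^ 6 + (W.baseChange (AlgebraicClosure K)).a₂ * r ^ 4 +
          (W.baseChange (AlgebraicClosure K)).a₄ * r ^ 2)) (by
        rw [Polynomial.degree_quadratic one_ne_zero]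
        exact two_ne_zero)
    exact ⟨τ, by simpa using hτ⟩
  obtain ⟨t, ht⟩ := hquad s
  obtain ⟨t', ht'⟩ := hquad s'
  -- the two automorphisms
  obtain ⟨α, hαmem, hα⟩ := exists_mem_endRing_apply_some_eq W h2 hσ hm hs ht
  obtain ⟨β, hβmem, hβ⟩ := exists_mem_endRing_apply_some_eq W h2 hσ hm hs' ht'
  refine ⟨⟨α, hαmem⟩, ⟨β, hβmem⟩, fun hab ↦ ?_⟩
  -- evaluate at an affine point
  obtain ⟨P, hP⟩ := exists_ne (0 : W.geomPoints)
  have e := congrArg (fun c : W.endRing ↦ (c : AddMonoid.End W.geomPoints) P) hab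
  change α (β P) = β (α P) at e
  change (W.baseChange (AlgebraicClosure K)).toAffine.Point at P
  rcases P with _ | ⟨x, y, h⟩
  · exact hP rfl
  obtain ⟨h₁, e₁⟩ := hβ x y h
  obtain ⟨h₂, e₂⟩ := hα _ _ h₁
  obtain ⟨h₃, e₃⟩ := hα x y h
  obtain ⟨h₄, e₄⟩ := hβ _ _ h₃
  rw [e₁, e₂, e₃, e₄] at e
  have hy := (Affine.Point.some.inj e).2
  have hzero : s * s' * (s' - s) = 0 := by linear_combination hy
  exact mul_ne_zero (mul_ne_zero hs0 hs'0) hss' hzero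

end Main

end WeierstrassCurve
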